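import Mathlib
import Literature.NumberTheory.LFunctions.KloostermanWeilFromPrime
import HarnessLib

/-!
# Kloosterman sums as hybrid character sums (Schmidt, Lemma II.12A) — PROVED

Topic `NumberTheory/LFunctions` (exponential sums); sixth file on
`Literature.NumberTheory.LFunctions.kloostermanSum`.  W. M. Schmidt, *Equations over Finite Fields.
An Elementary Approach*, LNM 536 (1976), Ch. II §12, Lemma 12A: for `q` odd, `χ` the quadratic
character of `𝔽_q`, `ψ ≠ ψ₀` and `ab ≠ 0`,
`∑_{x ∈ 𝔽_q^*} ψ(ax + bx⁻¹) = ∑_{x ∈ 𝔽_q} ψ(x) χ(x² − 4ab)` — "Solving `y = ax + bx⁻¹` for `x` we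
obtain `x = (2a)⁻¹(y ± √(y² − 4ab))` … `Z(y) = χ(y² − 4ab) + 1`".  This is how the elementary
(Stepanov–Schmidt) proof of Weil's bound `|S(a, b; p)| ≤ 2√p` (Schmidt's Theorem II.2H, the tree's
named fact `weil_kloosterman_bound_prime`) begins: it turns the Kloosterman sum into a hybrid sum
`∑ ψ(x) χ(f(x))` with `f` quadratic, to which the `L`-function method (Schmidt II §§8–11 and
Theorem I.2A) applies.  We PROVE, for `p` an odd prime and `a, b ∈ (ℤ/pℤ)ˣ`:

* `card_filter_kloosterman_fiber` — `#{x ≠ 0 : ax + bx⁻¹ = y} = #{u : u² = y² − 4ab}`;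
* `kloostermanSum_eq_hybridSum` — `S(a, b; p) = ∑_{y mod p} e(y/p) χ(y² − 4ab)` (Lemma 12A);
* `weil_kloosterman_bound_prime_of_hybrid` — the hybrid-sum bound
  `|∑_y e(y/p) χ(y² − c)| ≤ 2√p` (`p` odd, `c ≢ 0`; Schmidt's Theorem II.2G with `m = 2`, `n = 1`)
  implies `weil_kloosterman_bound_prime` (the case `p = 2` being trivial).

## References

* W. M. Schmidt, *Equations over Finite Fields. An Elementary Approach*, Lecture Notes in Math. 536,
  Springer (1976), Ch. II, §2 (Theorems 2G, 2H) and §12 (Lemma 12A).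
* A. Weil, *On some exponential sums*, Proc. Nat. Acad. Sci. USA 34 (1948) 204–207.
-/

noncomputable section

open Finset

namespace Literature.NumberTheory.LFunctions

section Prime

variable {p : ℕ} [hp : Fact p.Prime]

/-- For `a ≠ 0` and `x ≠ 0`: `ax + bx⁻¹ = y ↔ (2ax − y)² = y² − 4ab`. [folklore] -/
theorem kloosterman_fiber_iff (hp2 : p ≠ 2) {a b x : ZMod p} (ha : a ≠ 0) (hx : x ≠ 0) (y : ZMod p) :
    a * x + b * x⁻¹ = y ↔ (2 * a * x - y) ^ 2 = y ^ 2 - 4 * a * b := by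
  have h2 : (2 : ZMod p) ≠ 0 := by
    intro h
    have : ((2 : ℕ) : ZMod p) = 0 := by exact_mod_cast h
    rw [ZMod.natCast_eq_zero_iff, Nat.prime_dvd_prime_iff_eq hp.out Nat.prime_two] at this
    exact hp2 this
  constructor
  · intro h
    have h' : a * x * x + b = y * x := by
      have := congrArg (· * x) h
      simpa [add_mul, mul_assoc, inv_mul_cancel₀ hx] using this
    linear_combination (4 * a) * h'
  · intro h
    have h' : 4 * a * (a * x * x + b - y * x) = 0 := by linear_combination h
    have h4a : (4 : ZMod p) * a ≠ 0 := mul_ne_zero (by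
      rw [show (4 : ZMod p) = 2 * 2 by norm_num]; exact mul_ne_zero h2 h2) ha
    have h'' : a * x * x + b - y * x = 0 := (mul_eq_zero.mp h').resolve_left h4a
    have := congrArg (· * x⁻¹) h''
    simp only [zero_mul, sub_mul, add_mul, mul_assoc, mul_inv_cancel₀ hx, mul_one] at this
    linear_combination this

/-- **The fibres of `x ↦ ax + bx⁻¹`** (`p` odd, `ab ≠ 0`): the number of `x ≠ 0` with
`ax + bx⁻¹ = y` equals the number of square roots of `y² − 4ab` ("`Z(y) = χ(y² − 4ab) + 1`",
Schmidt p. 84). [cite: Schmidt1976, Ch. II §12, Lemma 12A] -/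
theorem card_filter_kloosterman_fiber (hp2 : p ≠ 2) {a b : ZMod p} (ha : a ≠ 0) (hb : b ≠ 0)
    (y : ZMod p) :
    ((Finset.univ.erase (0 : ZMod p)).filter fun x => a * x + b * x⁻¹ = y).card =
      (Finset.univ.filter fun u : ZMod p => u ^ 2 = y ^ 2 - 4 * a * b).card := by
  classical
  have h2 : (2 : ZMod p) ≠ 0 := by
    intro h
    have : ((2 : ℕ) : ZMod p) = 0 := by exact_mod_cast h
    rw [ZMod.natCast_eq_zero_iff, Nat.prime_dvd_prime_iff_eq hp.out Nat.prime_two] at this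
    exact hp2 this
  have h2a : (2 : ZMod p) * a ≠ 0 := mul_ne_zero h2 ha
  refine Finset.card_bij (fun x _ => 2 * a * x - y) ?_ ?_ ?_
  · intro x hx
    rw [Finset.mem_filter, Finset.mem_erase] at hx
    rw [Finset.mem_filter]
    exact ⟨Finset.mem_univ _, (kloosterman_fiber_iff hp2 ha hx.1.1 y).mp hx.2⟩
  · intro x _ x' _ h
    have : 2 * a * x = 2 * a * x' := by linear_combination h
    exact mul_left_cancel₀ h2a this
  · intro u hu
    rw [Finset.mem_filter] at hu
    refine ⟨(2 * a)⁻¹ * (u + y), ?_, ?_⟩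
    · rw [Finset.mem_filter, Finset.mem_erase]
      have hx0 : (2 * a)⁻¹ * (u + y) ≠ 0 := by
        refine mul_ne_zero (inv_ne_zero h2a) fun huy => ?_
        have hu' : u = -y := by linear_combination huy
        rw [hu'] at hu
        have : (4 : ZMod p) * a * b = 0 := by linear_combination hu.2
        have h4 : (4 : ZMod p) ≠ 0 := by
          rw [show (4 : ZMod p) = 2 * 2 by norm_num]; exact mul_ne_zero h2 h2
        exact (mul_ne_zero (mul_ne_zero h4 ha) hb) this
      refine ⟨⟨hx0, Finset.mem_univ _⟩, ?_⟩
      rw [kloosterman_fiber_iff hp2 ha hx0 y]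
      have : 2 * a * ((2 * a)⁻¹ * (u + y)) - y = u := by
        rw [← mul_assoc, mul_inv_cancel₀ h2a, one_mul]; ring
      rw [this]; exact hu.2
    · rw [← mul_assoc, mul_inv_cancel₀ h2a, one_mul]; ring

/-- **Schmidt, Lemma II.12A — PROVED:** for `p` odd and `ab ≢ 0 (mod p)`,
`S(a, b; p) = ∑_{y mod p} e(y/p) χ(y² − 4ab)` with `χ` the Legendre symbol
(Mathlib's `quadraticChar (ZMod p)`). [cite: Schmidt1976, Ch. II §12, Lemma 12A] -/
theorem kloostermanSum_eq_hybridSum (hp2 : p ≠ 2) {a b : ZMod p} (ha : a ≠ 0) (hb : b ≠ 0) :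
    kloostermanSum p a b =
      ∑ y : ZMod p, (ZMod.stdAddChar y : ℂ) * (quadraticChar (ZMod p) (y ^ 2 - 4 * a * b) : ℂ) := by
  classical
  have hchar : ringChar (ZMod p) ≠ 2 := by rw [ZMod.ringChar_zmod_n]; exact hp2
  -- the Kloosterman sum as a sum over `x ≠ 0`
  have hS : kloostermanSum p a b =
      ∑ x ∈ Finset.univ.erase (0 : ZMod p), (ZMod.stdAddChar (a * x + b * x⁻¹) : ℂ) := by
    unfold kloostermanSum
    rw [← Finset.sum_filter]
    refine Finset.sum_congr ?_ fun x _ => rfl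
    ext x
    simp only [Finset.mem_filter, Finset.mem_univ, true_and, Finset.mem_erase, and_true]
    exact isUnit_iff_ne_zero
  -- group by the value `y = ax + bx⁻¹`
  have hfib : ∑ x ∈ Finset.univ.erase (0 : ZMod p), (ZMod.stdAddChar (a * x + b * x⁻¹) : ℂ) =
      ∑ y : ZMod p, (((Finset.univ.erase (0 : ZMod p)).filter
        fun x => a * x + b * x⁻¹ = y).card : ℂ) * (ZMod.stdAddChar y : ℂ) := by
    rw [← Finset.sum_fiberwise_of_maps_to (s := Finset.univ.erase (0 : ZMod p)) (t := Finset.univ)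
      (g := fun x => a * x + b * x⁻¹) (fun x _ => Finset.mem_univ _)]
    refine Finset.sum_congr rfl fun y _ => ?_
    rw [Finset.sum_congr rfl (fun x hx => by rw [(Finset.mem_filter.mp hx).2]), Finset.sum_const,
      nsmul_eq_mul]
  -- the fibre count is `χ(y² − 4ab) + 1`
  have hcount : ∀ y : ZMod p, (((Finset.univ.erase (0 : ZMod p)).filter
      fun x => a * x + b * x⁻¹ = y).card : ℂ) = (quadraticChar (ZMod p) (y ^ 2 - 4 * a * b) : ℂ) + 1 := by
    intro y
    rw [card_filter_kloosterman_fiber hp2 ha hb y]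
    have h := quadraticChar_card_sqrts hchar (y ^ 2 - 4 * a * b)
    rw [Set.toFinset_setOf] at h
    exact_mod_cast congrArg (fun z : ℤ => (z : ℂ)) h
  -- the trivial character sums to zero
  have hzero : ∑ y : ZMod p, (ZMod.stdAddChar y : ℂ) = 0 := by
    have h := AddChar.sum_mulShift (1 : ZMod p) (ZMod.isPrimitive_stdAddChar p)
    simp only [mul_one, one_ne_zero, if_false, Nat.cast_zero] at h
    exact h
  rw [hS, hfib, Finset.sum_congr rfl fun y _ => by rw [hcount y]]
  simp_rw [add_mul, one_mul]
  rw [Finset.sum_add_distrib, hzero, add_zero]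
  exact Finset.sum_congr rfl fun y _ => mul_comm _ _

end Prime

/-- **Weil's Kloosterman bound at primes from the hybrid-sum bound — PROVED:** if
`|∑_{y mod p} e(y/p) χ(y² − c)| ≤ 2√p` for every odd prime `p` and `c ≢ 0` (the case `m = 2`,
`n = 1`, `d = 2` of Schmidt's Theorem II.2G), then `weil_kloosterman_bound_prime` holds (Lemma
12A; for `p = 2` the sum has one term). [cite: Schmidt1976, Ch. II §12] -/
theorem weil_kloosterman_bound_prime_of_hybrid
    (H : ∀ (p : ℕ) [Fact p.Prime], p ≠ 2 → ∀ c : ZMod p, c ≠ 0 →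
      ‖∑ y : ZMod p, (ZMod.stdAddChar y : ℂ) * (quadraticChar (ZMod p) (y ^ 2 - c) : ℂ)‖ ≤
        2 * Real.sqrt p) :
    weil_kloosterman_bound_prime := by
  intro p _ a b ha hb
  by_cases hp2 : p = 2
  · subst hp2
    refine (norm_kloostermanSum_le a b).trans ?_
    have : (1 : ℝ) ≤ Real.sqrt 2 := Real.one_le_sqrt.mpr (by norm_num)
    push_cast
    linarith
  · rw [kloostermanSum_eq_hybridSum hp2 ha hb]
    have hp : Fact p.Prime := inferInstance
    refine H p hp2 (4 * a * b) (mul_ne_zero (mul_ne_zero ?_ ha) hb)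
    intro h
    have h2 : ((2 : ℕ) : ZMod p) ≠ 0 := by
      rw [Ne, ZMod.natCast_eq_zero_iff, Nat.prime_dvd_prime_iff_eq hp.out Nat.prime_two]
      exact hp2
    have : (4 : ZMod p) = ((2 : ℕ) : ZMod p) * ((2 : ℕ) : ZMod p) := by push_cast; norm_num
    rw [this] at h
    exact (mul_ne_zero h2 h2) h

end Literature.NumberTheory.LFunctions

end
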